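import Mathlib
import Summits.MatrixMultiplication.MatrixMultiplication.Theorems.NilpotentLieHostsNilpotentThresholdDesignsStubRecenter

/-!
# `NilpotentThresholdDesigns` (stmt-MatrixMultiplication-7720) — the COMMUTING-MIDDLE CAP

A structural constraint on every design the crux `NilpotentThresholdDesigns` (route `NilpotentLieHosts`) can use,
recorded by the line lead (line `registered`, analysis note `Cruxes/NilpotentThresholdDesigns/Lines/birth-lead-c1.md`, R2).

**Theorem (abstract form).**  Let `G` be a group, `F` a finite-dimensional space of functions `G → ℂ` that is stable
under the left translations `f ↦ (m ↦ f (y⁻¹ m))` by the elements of `Y`, and let `X, Y, Z ⊂ G` be finite sets admitting,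
for every target `(x₀, z₀)`, a separating function `p ∈ F` (`p (x y⁻¹ y' z⁻¹) = [x = x₀ ∧ y = y' ∧ z = z₀]`,
BCGPU24 Def 2.1; this already forces the triple product property in embedding form).
If the middle quotient set `Y⁻¹Y` commutes pointwise with `X`, then

  `|Y| · |X| · |Z| ≤ dim F`.

*Proof.* The `|Y||X||Z|` translates `q_{y,x₀,z₀} := (m ↦ p_{x₀,z₀} (y⁻¹ m))` lie in `F`, and evaluating at the points
`y' x z⁻¹` gives `q_{y,x₀,z₀}(y' x z⁻¹) = p_{x₀,z₀}(x y⁻¹ y' z⁻¹) = [(y,x₀,z₀) = (y',x,z)]` (commutation, then the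
separating property), so they are linearly independent.

**Theorem (the crux's vocabulary, `card_mul_card_mul_card_le_pow_of_commuting_middle`).** For finite sets
`X, Y, Z` of upper unitriangular elements of `SL(d, ℤ)` with separating polynomials of `(j−i)`-weighted degree `≤ s`
for every target (literally the third clause of `NilpotentThresholdDesigns`) and `[X, Y⁻¹Y] = 1`:

  `|Y| · |X| · |Z| ≤ (s + 1) ^ (d(d−1)/2)`.

Here `F` is the space of functions on the unitriangular subgroup `U` given by polynomials of weighted degree `≤ s`:
it is spanned by the `(s+1)^D` super-diagonal monomial functions with exponents `≤ s` (`D = d(d−1)/2`; on `U` the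
diagonal variables are `1` and the sub-diagonal ones `0`, `eval_monomial_unitriangular`), and it is stable under
left translation by `U` thanks to the landed `stub_recenter` (two-sided translation stability of the weighted degree).

**Why it matters for the crux.** Every design whose middle differences commute with `X` (every design in an abelian
host, every design with `X` central, …) has `|X||Y||Z| ≤ (s+1)^D`: exponent `D`, two thirds of the threshold
`(3/2)D − δ` the crux demands for every `δ > 0`.  Hence any witness of `NilpotentThresholdDesigns` must have `Y⁻¹Y`
non-commuting with both `X` and `Z` (the statement with right translations is symmetric).  This is the
function-space form of the classical remark that abelian groups cannot beat the trivial bound in the Cohn–Umans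
framework (CohnUmans2003 §2; BlasiakCohnGrochowPrattUmans2024 §1); it is recorded as a helper (`--supports`) of the
crux item, not as a refutation: the crux itself remains open.
-/

set_option linter.dupNamespace false

namespace Summit.MatrixMultiplication.MatrixMultiplication.Theorems.NilpotentThresholdDesigns

open scoped BigOperators

/-- **Commuting-middle cap.**  In any group, if a finite-dimensional space `F` of complex functions is stable under
left translation by the elements of `Y`, the finite sets `X, Y, Z` admit separating functions in `F` for every
target (BCGPU24 Def 2.1, which implies the TPP), and `Y⁻¹Y` commutes pointwise with `X`, then
`|Y| · |X| · |Z| ≤ finrank F`: the translates `m ↦ p_{x₀,z₀}(y⁻¹ m)` are linearly independent, being dual to the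
evaluations at the points `y' x z⁻¹`. -/
theorem card_mul_card_mul_card_le_finrank_of_commuting_middle {G : Type*} [Group G] [DecidableEq G]
    (F : Submodule ℂ (G → ℂ)) [FiniteDimensional ℂ F] (X Y Z : Finset G)
    (hF : ∀ y ∈ Y, ∀ f ∈ F, (fun m => f (y⁻¹ * m)) ∈ F)
    (hcomm : ∀ x ∈ X, ∀ y ∈ Y, ∀ y' ∈ Y, x * (y⁻¹ * y') = y⁻¹ * y' * x)
    (hsep : ∀ x₀ ∈ X, ∀ z₀ ∈ Z, ∃ p ∈ F, ∀ x ∈ X, ∀ y ∈ Y, ∀ y' ∈ Y, ∀ z ∈ Z,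
      p (x * y⁻¹ * y' * z⁻¹) = if x = x₀ ∧ y = y' ∧ z = z₀ then 1 else 0) :
    Y.card * X.card * Z.card ≤ Module.finrank ℂ F := by
  -- choose the separating functions
  choose p hpF hp using hsep
  -- the family of translates, indexed by `Y × X × Z`
  let v : (↥Y × ↥X × ↥Z) → F := fun i =>
    ⟨fun m => p i.2.1 i.2.1.2 i.2.2 i.2.2.2 ((i.1 : G)⁻¹ * m),
      hF i.1 i.1.2 _ (hpF i.2.1 i.2.1.2 i.2.2 i.2.2.2)⟩
  -- duality with the evaluations at `y' x z⁻¹`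
  have hdual : ∀ i j : ↥Y × ↥X × ↥Z,
      (v j : G → ℂ) ((i.1 : G) * ((i.2.1 : G) * (i.2.2 : G)⁻¹)) = if j = i then 1 else 0 := by
    rintro ⟨y', x, z⟩ ⟨y, x₀, z₀⟩
    change p x₀ x₀.2 z₀ z₀.2 ((y : G)⁻¹ * ((y' : G) * ((x : G) * (z : G)⁻¹))) = _
    have hrw : (y : G)⁻¹ * ((y' : G) * ((x : G) * (z : G)⁻¹)) = x * (y : G)⁻¹ * y' * (z : G)⁻¹ := by
      have hc := hcomm x x.2 y y.2 y' y'.2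
      calc (y : G)⁻¹ * ((y' : G) * ((x : G) * (z : G)⁻¹))
          = ((y : G)⁻¹ * y') * x * (z : G)⁻¹ := by group
        _ = (x * ((y : G)⁻¹ * y')) * (z : G)⁻¹ := by rw [hc]
        _ = x * (y : G)⁻¹ * y' * (z : G)⁻¹ := by group
    rw [hrw, hp x₀ x₀.2 z₀ z₀.2 x x.2 y y.2 y' y'.2 z z.2]
    by_cases h : (x : G) = x₀ ∧ (y : G) = y' ∧ (z : G) = z₀
    · rw [if_pos h, if_pos]
      obtain ⟨hx, hy, hz⟩ := h
      ext <;> simp [hx, hy, hz]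
    · rw [if_neg h, if_neg]
      rintro ⟨rfl⟩
      exact h ⟨rfl, rfl, rfl⟩
  -- linear independence of the translates
  have hli : LinearIndependent ℂ v := by
    rw [linearIndependent_iff']
    intro s g hsum i hi
    -- evaluate the vanishing combination at the point `y'_i x_i z_i⁻¹`
    have heval := congrArg (fun f : F => (f : G → ℂ) ((i.1 : G) * ((i.2.1 : G) * (i.2.2 : G)⁻¹))) hsum
    simp only [Submodule.coe_sum, Submodule.coe_smul, Finset.sum_apply, Pi.smul_apply, smul_eq_mul,
      Submodule.coe_zero, Pi.zero_apply] at heval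
    simp_rw [hdual i] at heval
    simpa [Finset.sum_ite_eq', hi] using heval
  -- count
  have hcard := hli.fintype_card_le_finrank
  simpa [Fintype.card_prod, Fintype.card_coe, mul_assoc, mul_comm, mul_left_comm] using hcard


/-! ## The `U_d(ℤ)` corollary: commuting-middle designs of the crux have `|X||Y||Z| ≤ (s+1)^(d²)` -/

section Unitriangular

open MvPolynomial

variable {d : ℕ}

/-- Products of upper unitriangular elements of `SL(d, ℤ)` are upper unitriangular. [folklore] -/
theorem unitriangular_mul {g h : Matrix.SpecialLinearGroup (Fin d) ℤ}
    (hg : ∀ i j : Fin d, j ≤ i → (g : Matrix (Fin d) (Fin d) ℤ) i j = if i = j then 1 else 0)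
    (hh : ∀ i j : Fin d, j ≤ i → (h : Matrix (Fin d) (Fin d) ℤ) i j = if i = j then 1 else 0) :
    ∀ i j : Fin d, j ≤ i →
      ((g * h : Matrix.SpecialLinearGroup (Fin d) ℤ) : Matrix (Fin d) (Fin d) ℤ) i j =
        if i = j then 1 else 0 := by
  intro i j hji
  rw [Matrix.SpecialLinearGroup.coe_mul, Matrix.mul_apply, Finset.sum_eq_single i]
  · rw [hg i i le_rfl, if_pos rfl, one_mul, hh i j hji]
  · intro k _ hki
    rcases lt_or_gt_of_ne hki with hlt | hgt
    · rw [hg i k hlt.le, if_neg (ne_of_gt hlt), zero_mul]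
    · rw [hh k j (hji.trans hgt.le), if_neg (ne_of_gt (lt_of_le_of_lt hji hgt)), mul_zero]
  · intro hi; exact absurd (Finset.mem_univ i) hi

/-- The identity of `SL(d, ℤ)` is upper unitriangular. [folklore] -/
theorem unitriangular_one :
    ∀ i j : Fin d, j ≤ i →
      ((1 : Matrix.SpecialLinearGroup (Fin d) ℤ) : Matrix (Fin d) (Fin d) ℤ) i j = if i = j then 1 else 0 := by
  intro i j _
  rw [Matrix.SpecialLinearGroup.coe_one, Matrix.one_apply]

/-- Inverses of upper unitriangular elements of `SL(d, ℤ)` are upper unitriangular. [folklore] -/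
theorem unitriangular_inv {g : Matrix.SpecialLinearGroup (Fin d) ℤ}
    (hg : ∀ i j : Fin d, j ≤ i → (g : Matrix (Fin d) (Fin d) ℤ) i j = if i = j then 1 else 0) :
    ∀ i j : Fin d, j ≤ i →
      ((g⁻¹ : Matrix.SpecialLinearGroup (Fin d) ℤ) : Matrix (Fin d) (Fin d) ℤ) i j = if i = j then 1 else 0 := by
  -- `g⁻¹` is upper triangular (block-triangularity of the inverse, `det g = 1`)
  have hgt : (g : Matrix (Fin d) (Fin d) ℤ).BlockTriangular id :=
    fun i j (hij : j < i) => by rw [hg i j hij.le, if_neg hij.ne']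
  have hdet : IsUnit (g : Matrix (Fin d) (Fin d) ℤ).det := by
    rw [Matrix.SpecialLinearGroup.det_coe]; exact isUnit_one
  letI : Invertible (g : Matrix (Fin d) (Fin d) ℤ) := Matrix.invertibleOfIsUnitDet _ hdet
  have hGt : ((g⁻¹ : Matrix.SpecialLinearGroup (Fin d) ℤ) : Matrix (Fin d) (Fin d) ℤ).BlockTriangular id := by
    have e : ((g⁻¹ : Matrix.SpecialLinearGroup (Fin d) ℤ) : Matrix (Fin d) (Fin d) ℤ) =
        (g : Matrix (Fin d) (Fin d) ℤ)⁻¹ := by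
      rw [Matrix.SpecialLinearGroup.coe_inv, Matrix.inv_def, Matrix.SpecialLinearGroup.det_coe,
        Ring.inverse_one, one_smul]
    rw [e]
    exact Matrix.blockTriangular_inv_of_blockTriangular hgt
  intro i j hji
  rcases hji.lt_or_eq with hlt | heq
  · rw [hGt hlt, if_neg (ne_of_gt hlt)]
  · subst heq
    rw [if_pos rfl]
    -- the diagonal: read off `(g * g⁻¹)_{j j} = 1`
    have h1 : ((g * g⁻¹ : Matrix.SpecialLinearGroup (Fin d) ℤ) : Matrix (Fin d) (Fin d) ℤ) j j = 1 := by
      rw [mul_inv_cancel, Matrix.SpecialLinearGroup.coe_one, Matrix.one_apply_eq]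
    rw [Matrix.SpecialLinearGroup.coe_mul, Matrix.mul_apply, Finset.sum_eq_single j] at h1
    · rwa [hg j j le_rfl, if_pos rfl, one_mul] at h1
    · intro k _ hkj
      rcases lt_or_gt_of_ne hkj with hlt | hgt
      · rw [hg j k hlt.le, if_neg (ne_of_gt hlt), zero_mul]
      · rw [hGt hgt, mul_zero]
    · intro hj; exact absurd (Finset.mem_univ j) hj

/-- Evaluation of a monomial at an upper-unitriangular point: variables on the diagonal evaluate to `1`, below it
to `0`, so the value is that of the monomial restricted to the super-diagonal variables, or `0` if a sub-diagonal
variable occurs. [folklore] -/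
theorem eval_monomial_unitriangular (P : Fin d × Fin d → ℂ) (hdiag : ∀ i : Fin d, P (i, i) = 1)
    (hlow : ∀ i j : Fin d, j < i → P (i, j) = 0) (m : Fin d × Fin d →₀ ℕ) (c : ℂ) :
    MvPolynomial.eval P (monomial m c) =
      if ∀ ij ∈ m.support, ¬ ij.2 < ij.1 then
        MvPolynomial.eval P (monomial (m.filter fun ij => ij.1 < ij.2) c) else 0 := by
  rw [eval_monomial, eval_monomial]
  split_ifs with h
  · congr 1
    rw [← Finsupp.prod_filter_mul_prod_filter_not (p := fun ij : Fin d × Fin d => ij.1 < ij.2) m]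
    suffices hB : ((m.filter fun ij : Fin d × Fin d => ¬ ij.1 < ij.2).prod fun n e => P n ^ e) = 1 by
      rw [hB, mul_one]
    rw [Finsupp.prod]
    refine Finset.prod_eq_one fun ij hij => ?_
    rw [Finsupp.support_filter, Finset.mem_filter] at hij
    obtain ⟨i, j⟩ := ij
    have hji : ¬ j < i := h (i, j) hij.1
    have hij' : ¬ i < j := hij.2
    have heq : i = j := le_antisymm (not_lt.mp hji) (not_lt.mp hij')
    subst heq
    rw [hdiag i, one_pow]
  · push Not at h
    obtain ⟨⟨i, j⟩, hij, hlt⟩ := h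
    rw [Finsupp.prod, Finset.prod_eq_zero hij, mul_zero]
    rw [hlow i j hlt, zero_pow]
    exact Finsupp.mem_support_iff.mp hij

/-- **Commuting-middle cap in `U_d(ℤ)`** (the route's vocabulary).  If finite sets `X, Y, Z` of upper unitriangular
elements of `SL(d, ℤ)` admit separating polynomials of `(j−i)`-weighted degree `≤ s` for every target (literally the
third clause of `NilpotentThresholdDesigns`) and the middle differences `y⁻¹y'` commute with every `x ∈ X`, then
`|Y|·|X|·|Z| ≤ (s+1)^(d(d−1)/2) = (s+1)^D`: exponent at most `D` in `s`, whereas the crux demands `s^((3/2)D − δ)` for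
every `δ > 0`.  So no abelian-host design, no design with central `X`, and more generally no design whose middle
quotient set centralises `X` (or, symmetrically, `Z`) can witness the crux.  Proof: restrict the polynomials of weighted
degree `≤ s` to functions on the unitriangular subgroup (they are spanned by the `(s+1)^D` super-diagonal monomial
functions with exponents `≤ s`; this space is stable under unitriangular left translation by the landed
`stub_recenter`) and apply `card_mul_card_mul_card_le_finrank_of_commuting_middle`. -/
theorem card_mul_card_mul_card_le_pow_of_commuting_middle :
    ∀ (d s : ℕ) (X Y Z : Finset (Matrix.SpecialLinearGroup (Fin d) ℤ)),
    (∀ g ∈ X ∪ Y ∪ Z, ∀ i j : Fin d, j ≤ i → (g : Matrix (Fin d) (Fin d) ℤ) i j = if i = j then 1 else 0) →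
    (∀ x ∈ X, ∀ y ∈ Y, ∀ y' ∈ Y, x * (y⁻¹ * y') = y⁻¹ * y' * x) →
    (∀ x₀ ∈ X, ∀ z₀ ∈ Z, ∃ p : MvPolynomial (Fin d × Fin d) ℂ,
      MvPolynomial.weightedTotalDegree (fun ij : Fin d × Fin d => (ij.2 : ℕ) - ij.1) p ≤ s ∧
      ∀ x ∈ X, ∀ y ∈ Y, ∀ y' ∈ Y, ∀ z ∈ Z, MvPolynomial.eval (fun ij : Fin d × Fin d =>
        (((x * y⁻¹ * y' * z⁻¹ : Matrix.SpecialLinearGroup (Fin d) ℤ) : Matrix (Fin d) (Fin d) ℤ) ij.1 ij.2 : ℂ)) p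
          = if x = x₀ ∧ y = y' ∧ z = z₀ then 1 else 0) →
    Y.card * X.card * Z.card ≤ (s + 1) ^ (d * (d - 1) / 2) := by
  intro d s X Y Z hU hcomm hsep
  classical
  -- the unitriangular subgroup `U` and the three sets inside it
  let U : Subgroup (Matrix.SpecialLinearGroup (Fin d) ℤ) :=
    { carrier := {g | ∀ i j : Fin d, j ≤ i → (g : Matrix (Fin d) (Fin d) ℤ) i j = if i = j then 1 else 0}
      mul_mem' := fun hg hh => unitriangular_mul hg hh
      one_mem' := unitriangular_one
      inv_mem' := fun hg => unitriangular_inv hg }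
  have hXU : ∀ x ∈ X, x ∈ U := fun x hx => hU x (Finset.mem_union_left _ (Finset.mem_union_left _ hx))
  have hYU : ∀ y ∈ Y, y ∈ U := fun y hy => hU y (Finset.mem_union_left _ (Finset.mem_union_right _ hy))
  have hZU : ∀ z ∈ Z, z ∈ U := fun z hz => hU z (Finset.mem_union_right _ hz)
  let X' : Finset U := X.subtype (· ∈ U)
  let Y' : Finset U := Y.subtype (· ∈ U)
  let Z' : Finset U := Z.subtype (· ∈ U)
  have hX' : X'.card = X.card := by rw [Finset.card_subtype, Finset.filter_true_of_mem hXU]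
  have hY' : Y'.card = Y.card := by rw [Finset.card_subtype, Finset.filter_true_of_mem hYU]
  have hZ' : Z'.card = Z.card := by rw [Finset.card_subtype, Finset.filter_true_of_mem hZU]
  -- points and the evaluation map into functions on `U`
  let pt : U → Fin d × Fin d → ℂ := fun u ij =>
    (((u : Matrix.SpecialLinearGroup (Fin d) ℤ) : Matrix (Fin d) (Fin d) ℤ) ij.1 ij.2 : ℂ)
  let evL : MvPolynomial (Fin d × Fin d) ℂ →ₗ[ℂ] (U → ℂ) :=
    LinearMap.pi fun u => (MvPolynomial.aeval (pt u)).toLinearMap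
  have evL_apply : ∀ p u, evL p u = MvPolynomial.eval (pt u) p := fun p u => rfl
  let w : Fin d × Fin d → ℕ := fun ij => (ij.2 : ℕ) - ij.1
  -- the function space `F = {u ↦ p(u) : wdeg p ≤ s}` and a finite spanning family of monomial functions
  let S : Set (U → ℂ) := {f | ∃ p : MvPolynomial (Fin d × Fin d) ℂ, weightedTotalDegree w p ≤ s ∧ f = evL p}
  let F : Submodule ℂ (U → ℂ) := Submodule.span ℂ S
  let fam : ({ij : Fin d × Fin d // ij.1 < ij.2} → Fin (s + 1)) → (U → ℂ) := fun e =>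
    evL (monomial (Finsupp.equivFunOnFinite.symm fun ij : Fin d × Fin d =>
      if h : ij.1 < ij.2 then (e ⟨ij, h⟩ : ℕ) else 0) 1)
  let F₀ : Submodule ℂ (U → ℂ) := Submodule.span ℂ (Set.range fam)
  haveI : FiniteDimensional ℂ F₀ := FiniteDimensional.span_of_finite ℂ (Set.finite_range fam)
  -- every `evL p` with `wdeg p ≤ s` lies in `F₀`
  have hmono : ∀ (m : Fin d × Fin d →₀ ℕ) (c : ℂ), Finsupp.weight w m ≤ s → evL (monomial m c) ∈ F₀ := by
    intro m c hm
    have hpt : ∀ u : U, MvPolynomial.eval (pt u) (monomial m c) =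
        if ∀ ij ∈ m.support, ¬ ij.2 < ij.1 then
          MvPolynomial.eval (pt u) (monomial (m.filter fun ij => ij.1 < ij.2) c) else 0 := by
      intro u
      refine eval_monomial_unitriangular (pt u) (fun i => ?_) (fun i j hji => ?_) m c
      · show (((u : Matrix.SpecialLinearGroup (Fin d) ℤ) : Matrix (Fin d) (Fin d) ℤ) i i : ℂ) = 1
        rw [u.2 i i le_rfl, if_pos rfl, Int.cast_one]
      · show (((u : Matrix.SpecialLinearGroup (Fin d) ℤ) : Matrix (Fin d) (Fin d) ℤ) i j : ℂ) = 0
        rw [u.2 i j hji.le, if_neg (ne_of_gt hji), Int.cast_zero]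
    by_cases hcond : ∀ ij ∈ m.support, ¬ ij.2 < ij.1
    · -- reduce to the super-diagonal monomial, which is `c •` a member of the family
      let m' : Fin d × Fin d →₀ ℕ := m.filter fun ij => ij.1 < ij.2
      have hm' : ∀ ij, m' ij ≤ s := by
        rintro ⟨i, j⟩
        by_cases hij : i < j
        · have hw : w (i, j) ≠ 0 := by
            show (j : ℕ) - i ≠ 0
            have := Fin.lt_def.mp hij
            omega
          calc m' (i, j) = m (i, j) :=
                Finsupp.filter_apply_pos (fun ij : Fin d × Fin d => ij.1 < ij.2) m (a := (i, j)) hij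
            _ ≤ Finsupp.weight w m := Finsupp.le_weight w hw m
            _ ≤ s := hm
        · show (m.filter fun ij : Fin d × Fin d => ij.1 < ij.2) (i, j) ≤ s
          rw [Finsupp.filter_apply_neg (fun ij : Fin d × Fin d => ij.1 < ij.2) m (a := (i, j)) hij]
          exact Nat.zero_le _
      let e : {ij : Fin d × Fin d // ij.1 < ij.2} → Fin (s + 1) := fun ij =>
        ⟨m' ij.1, Nat.lt_succ_of_le (hm' ij.1)⟩
      have hme : (Finsupp.equivFunOnFinite.symm fun ij : Fin d × Fin d =>
          if h : ij.1 < ij.2 then (e ⟨ij, h⟩ : ℕ) else 0) = m' := by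
        ext ⟨i, j⟩
        rw [Finsupp.coe_equivFunOnFinite_symm]
        split_ifs with hij
        · rfl
        · exact (Finsupp.filter_apply_neg (fun ij : Fin d × Fin d => ij.1 < ij.2) m (a := (i, j)) hij).symm
      have hfun : evL (monomial m c) = c • fam e := by
        funext u
        rw [Pi.smul_apply, evL_apply, hpt u, if_pos hcond, smul_eq_mul]
        show _ = c * evL _ u
        rw [evL_apply, hme, eval_monomial, eval_monomial, one_mul]
      rw [hfun]
      exact F₀.smul_mem c (Submodule.subset_span ⟨e, rfl⟩)
    · have hzero : evL (monomial m c) = 0 := by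
        funext u; rw [evL_apply, hpt u, if_neg hcond]; rfl
      rw [hzero]; exact F₀.zero_mem
  have hevL : ∀ p : MvPolynomial (Fin d × Fin d) ℂ, weightedTotalDegree w p ≤ s → evL p ∈ F₀ := by
    intro p hp
    rw [p.as_sum, map_sum]
    refine F₀.sum_mem fun m hm => hmono m _ ((le_weightedTotalDegree w hm).trans hp)
  have hFle : F ≤ F₀ := Submodule.span_le.mpr (by rintro f ⟨p, hp, rfl⟩; exact hevL p hp)
  haveI : FiniteDimensional ℂ F := Submodule.finiteDimensional_of_le hFle
  -- translation stability of `F` under `u ↦ y⁻¹ u`, `y ∈ Y'` (the landed `stub_recenter` with `h = 1`)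
  have hF : ∀ y ∈ Y', ∀ f ∈ F, (fun m => f (y⁻¹ * m)) ∈ F := by
    intro y _ f hf
    let T : (U → ℂ) →ₗ[ℂ] (U → ℂ) := LinearMap.funLeft ℂ ℂ fun m : U => y⁻¹ * m
    have hT : ∀ g : U → ℂ, T g = fun m => g (y⁻¹ * m) := fun g => rfl
    rw [← hT]
    have hmap : F.map T ≤ F := by
      rw [Submodule.map_span, Submodule.span_le]
      rintro _ ⟨f', ⟨p, hp, rfl⟩, rfl⟩
      obtain ⟨p', hp'deg, hp'val⟩ :=
        stub_recenter d (y : Matrix.SpecialLinearGroup (Fin d) ℤ) 1 y.2 unitriangular_one p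
      refine Submodule.subset_span ⟨p', hp'deg.trans hp, ?_⟩
      funext m
      show MvPolynomial.eval (pt (y⁻¹ * m)) p = MvPolynomial.eval (pt m) p'
      rw [show MvPolynomial.eval (pt m) p' = _ from hp'val (m : Matrix.SpecialLinearGroup (Fin d) ℤ)]
      have harg : pt (y⁻¹ * m) = fun ij : Fin d × Fin d =>
          ((((y : Matrix.SpecialLinearGroup (Fin d) ℤ)⁻¹ * (m : Matrix.SpecialLinearGroup (Fin d) ℤ) * 1 :
            Matrix.SpecialLinearGroup (Fin d) ℤ) : Matrix (Fin d) (Fin d) ℤ) ij.1 ij.2 : ℂ) := by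
        funext ij; simp only [pt, mul_one, Subgroup.coe_mul, Subgroup.coe_inv]
      rw [harg]
    exact hmap (Submodule.mem_map_of_mem hf)
  -- commutation and separation inside `U`
  have hcomm' : ∀ x ∈ X', ∀ y ∈ Y', ∀ y' ∈ Y', x * (y⁻¹ * y') = y⁻¹ * y' * x := by
    intro x hx y hy y' hy'
    rw [Finset.mem_subtype] at hx hy hy'
    apply Subtype.ext
    simp only [Subgroup.coe_mul, Subgroup.coe_inv]
    exact hcomm _ hx _ hy _ hy'
  have hsep' : ∀ x₀ ∈ X', ∀ z₀ ∈ Z', ∃ f ∈ F, ∀ x ∈ X', ∀ y ∈ Y', ∀ y' ∈ Y', ∀ z ∈ Z',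
      f (x * y⁻¹ * y' * z⁻¹) = if x = x₀ ∧ y = y' ∧ z = z₀ then 1 else 0 := by
    intro x₀ hx₀ z₀ hz₀
    rw [Finset.mem_subtype] at hx₀ hz₀
    obtain ⟨p, hpdeg, hpval⟩ := hsep _ hx₀ _ hz₀
    refine ⟨evL p, Submodule.subset_span ⟨p, hpdeg, rfl⟩, ?_⟩
    intro x hx y hy y' hy' z hz
    rw [Finset.mem_subtype] at hx hy hy' hz
    rw [evL_apply]
    have hpt : pt (x * y⁻¹ * y' * z⁻¹) = fun ij : Fin d × Fin d =>
        ((((x : Matrix.SpecialLinearGroup (Fin d) ℤ) * (y : Matrix.SpecialLinearGroup (Fin d) ℤ)⁻¹ * y' *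
          (z : Matrix.SpecialLinearGroup (Fin d) ℤ)⁻¹ : Matrix.SpecialLinearGroup (Fin d) ℤ) :
            Matrix (Fin d) (Fin d) ℤ) ij.1 ij.2 : ℂ) := by
      funext ij; simp only [pt, Subgroup.coe_mul, Subgroup.coe_inv]
    rw [hpt, hpval _ hx _ hy _ hy' _ hz]
    simp only [Subtype.ext_iff]
  -- the abstract cap, then the dimension count
  have hcap := card_mul_card_mul_card_le_finrank_of_commuting_middle F X' Y' Z' hF hcomm' hsep'
  -- `#{(i, j) : i < j} = d(d−1)/2`
  have hD : Fintype.card {ij : Fin d × Fin d // ij.1 < ij.2} = d * (d - 1) / 2 := by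
    rw [Fintype.card_subtype, Finset.card_filter, Fintype.sum_prod_type]
    have hrow : ∀ i : Fin d, (∑ j : Fin d, if i < j then 1 else 0) = d - 1 - (i : ℕ) := by
      intro i
      rw [← Finset.card_filter]
      have hIoi : (Finset.univ.filter fun j : Fin d => i < j) = Finset.Ioi i := by
        ext j; simp [Finset.mem_Ioi]
      rw [hIoi, Fin.card_Ioi]
    simp_rw [hrow]
    rw [Fin.sum_univ_eq_sum_range (fun k => d - 1 - k) d, Finset.sum_range_reflect (fun k => k) d,
      Finset.sum_range_id]
  have hdim : Module.finrank ℂ F ≤ (s + 1) ^ (d * (d - 1) / 2) := by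
    refine (Submodule.finrank_mono hFle).trans ?_
    have h := finrank_range_le_card (R := ℂ) fam
    simp only [Set.finrank, Fintype.card_fun, Fintype.card_fin, hD] at h
    exact h
  rw [hX', hY', hZ'] at hcap
  exact hcap.trans hdim

end Unitriangular

end Summit.MatrixMultiplication.MatrixMultiplication.Theorems.NilpotentThresholdDesigns
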